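import Summits.AtomisticToContinuum.HydrodynamicLimit.Theorems.TwoClocksClampedWindowDockClampRemainder
import Literature.MathematicalPhysics.KineticTheory.HardSphereEuler
import HarnessLib

/-!
# The TRANSFER-clamp remainder bound (stub `stub_transferClampRemainder`, line `IdeatorTwoSketch`,
# crux `ClampedCurrentsDock`, stmt-AtomisticToContinuum-14680)

Helper file (`--supports stmt-AtomisticToContinuum-14680`) proving the registered stub
`stub_transferClampRemainder : TransferClampRemainder` of the lead's skeleton
(`Cruxes/ClampedCurrentsDock/Lines/IdeatorTwoSketch.lean`). It generalises the twin dock's momentum-impulse lemma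
`EntropyClockDock.abs_collisionSum_unclamped_le` (13735, part V) to the TRANSFER impulse
`ι(c) = ‖v_fst⁺ − v_fst⁻‖ + |‖v_fst⁺‖² − ‖v_fst⁻‖²|/2` of the repaired collisional antecedent C′
(`ClampedTransferWindowLD`): along a curve in the torus hard-sphere geometry with finitely many collision times in
a window, for weights `ω : Fin N → [0,1]` and any functional of collision records with `|g c| ≤ B ι(c)`,
`|Σ_c (1 − ω_fst ω_snd) g c| ≤ 2B Σ_i (1 − ω_i) Σ_{c : c.fst = i} ι(c)`.
The one new ingredient is the swap symmetry of the ENERGY impulse (pair energy conservation,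
`HardSphereCollisionRecord.ofConfig_norm_sq_preVel`), next to that of the momentum impulse
(`EntropyClockDock.norm_postVel_snd_sub_preVel_snd`).
-/

noncomputable section

namespace Summit.AtomisticToContinuum.HydrodynamicLimit.Theorems.ClampedCurrentsDockClampRemainder

open MeasureTheory Filter Set Topology Finset
open Literature.MathematicalPhysics.KineticTheory Literature.Analysis.FluidPDE Literature.Analysis.FunctionSpaces
open Summit.AtomisticToContinuum.HydrodynamicLimit.Theorems.EntropyClockDock

/-- **S10 — the TRANSFER-clamp remainder bound (pathwise; generalises
`EntropyClockDock.abs_collisionSum_unclamped_le` from the momentum impulse to the transfer impulse).** For a curve in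
the torus hard-sphere geometry with finitely many collision times in the window `S`, weights `ω : Fin N → [0,1]` and a
functional `g` of collision records dominated by the TRANSFER impulse of the first partner,
`|g c| ≤ B (‖Δv_fst‖ + |‖v_fst⁺‖² − ‖v_fst⁻‖²|/2)`, the part of `Σ_c g c` dropped by the pair-symmetric clamp is
controlled by the clamped-out transfer activity:
`|Σ_c (1 − ω_fst ω_snd) g c| ≤ 2B Σ_i (1 − ω_i) A_i`, `A_i = Σ_{c : c.fst = i} (‖Δv_fst‖ + |Δ‖v_fst‖²|/2)` (the transfer
impulse is swap-symmetric by momentum AND energy conservation in the pair). With `ω_i = 1{a_i ≤ V}`, the momentum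
kernels `(φ(x_fst) − φ(x_snd))Δv^k/2` and the energy kernel `(φ(x_fst) − φ(x_snd))Δe/2`, `B = ‖∇φ‖_∞ε_N/2`: the ledger's
unclamped collisional remainder is `≤ ‖∇φ‖_∞ Σ_i a_i 1{a_i > V}` in transfer activity, priced by 13734 + the energy twin. -/
def TransferClampRemainder : Prop :=
  ∀ (ε : ℝ) (N : ℕ) (γ : ℝ → Config N (Fin 3) T3) (S : Set ℝ),
    (Torus.geometry (Fin 3)).IsHardSphereRegular ε →
    (collisionTimes (Torus.geometry (Fin 3)) ε γ ∩ S).Finite →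
    ∀ (ω : Fin N → ℝ), (∀ i, 0 ≤ ω i) → (∀ i, ω i ≤ 1) →
    ∀ (g : HardSphereCollisionRecord (Fin 3) T3 N → ℝ) (B : ℝ),
      (∀ t ∈ collisionTimes (Torus.geometry (Fin 3)) ε γ ∩ S, ∀ p ∈ contactPairs (Torus.geometry (Fin 3)) ε (γ t),
        |g (HardSphereCollisionRecord.ofConfig (Torus.geometry (Fin 3)) ε (γ t) t p.1 p.2)| ≤
          B * (‖(HardSphereCollisionRecord.ofConfig (Torus.geometry (Fin 3)) ε (γ t) t p.1 p.2).postVel.1 -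
                (HardSphereCollisionRecord.ofConfig (Torus.geometry (Fin 3)) ε (γ t) t p.1 p.2).preVel.1‖ +
            |‖(HardSphereCollisionRecord.ofConfig (Torus.geometry (Fin 3)) ε (γ t) t p.1 p.2).postVel.1‖ ^ 2 -
                ‖(HardSphereCollisionRecord.ofConfig (Torus.geometry (Fin 3)) ε (γ t) t p.1 p.2).preVel.1‖ ^ 2| / 2)) →
      |collisionSum (Torus.geometry (Fin 3)) ε γ S (fun c => (1 - ω c.fst * ω c.snd) * g c)| ≤
        2 * B * ∑ i, (1 - ω i) * collisionSum (Torus.geometry (Fin 3)) ε γ S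
          (fun c => if c.fst = i then ‖c.postVel.1 - c.preVel.1‖ + |‖c.postVel.1‖ ^ 2 - ‖c.preVel.1‖ ^ 2| / 2 else 0)

variable {d : Type*} [Fintype d] {X : Type*} [TopologicalSpace X] {N : ℕ} {G : Geometry d X} {ε : ℝ}

omit [TopologicalSpace X] in
/-- **Opposite energy impulses**: in every record computed from a configuration the second partner's energy jump
has the absolute value of the first partner's (pair energy conservation
`‖v_i⁻‖² + ‖v_j⁻‖² = ‖v_i⁺‖² + ‖v_j⁺‖²`). [folklore] -/
theorem abs_normSq_postVel_snd_sub (z : Config N d X) (t : ℝ) (i j : Fin N) :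
    |‖(HardSphereCollisionRecord.ofConfig G ε z t i j).postVel.2‖ ^ 2 -
        ‖(HardSphereCollisionRecord.ofConfig G ε z t i j).preVel.2‖ ^ 2| =
      |‖(HardSphereCollisionRecord.ofConfig G ε z t i j).postVel.1‖ ^ 2 -
        ‖(HardSphereCollisionRecord.ofConfig G ε z t i j).preVel.1‖ ^ 2| := by
  have h := HardSphereCollisionRecord.ofConfig_norm_sq_preVel G ε z t i j
  rw [show ‖(HardSphereCollisionRecord.ofConfig G ε z t i j).postVel.2‖ ^ 2 -
      ‖(HardSphereCollisionRecord.ofConfig G ε z t i j).preVel.2‖ ^ 2 =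
      -(‖(HardSphereCollisionRecord.ofConfig G ε z t i j).postVel.1‖ ^ 2 -
        ‖(HardSphereCollisionRecord.ofConfig G ε z t i j).preVel.1‖ ^ 2) by linarith, abs_neg]

/-- **The transfer impulse is swap-symmetric** at contact in a regular geometry: the record of `(j, i)` has the
transfer impulse of the record of `(i, j)`. [folklore] -/
theorem transferImpulse_swap (hG : G.IsHardSphereRegular ε) {z : Config N d X} {i j : Fin N}
    (h : ‖G.sepVec (z i).1 (z j).1‖ ≤ ε) (t : ℝ) :
    ‖(HardSphereCollisionRecord.ofConfig G ε z t j i).postVel.1 -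
        (HardSphereCollisionRecord.ofConfig G ε z t j i).preVel.1‖ +
      |‖(HardSphereCollisionRecord.ofConfig G ε z t j i).postVel.1‖ ^ 2 -
        ‖(HardSphereCollisionRecord.ofConfig G ε z t j i).preVel.1‖ ^ 2| / 2 =
    ‖(HardSphereCollisionRecord.ofConfig G ε z t i j).postVel.1 -
        (HardSphereCollisionRecord.ofConfig G ε z t i j).preVel.1‖ +
      |‖(HardSphereCollisionRecord.ofConfig G ε z t i j).postVel.1‖ ^ 2 -
        ‖(HardSphereCollisionRecord.ofConfig G ε z t i j).preVel.1‖ ^ 2| / 2 := by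
  rw [ofConfig_swap_postVel_fst z t i j, ofConfig_swap_preVel_fst hG h, norm_postVel_snd_sub_preVel_snd,
    abs_normSq_postVel_snd_sub]

/-- **Swap re-indexing for the transfer impulse.** For a curve in a regular geometry with finitely many collision
times in `S`, summing `f (c.snd) · ι(c)` over the ordered collision records equals summing `f (c.fst) · ι(c)`.
[folklore] -/
theorem collisionSum_snd_eq_fst_transfer (hG : G.IsHardSphereRegular ε) {γ : ℝ → Config N d X} {S : Set ℝ}
    (hfin : (collisionTimes G ε γ ∩ S).Finite) (f : Fin N → ℝ) :
    collisionSum G ε γ S (fun c => f c.snd *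
        (‖c.postVel.1 - c.preVel.1‖ + |‖c.postVel.1‖ ^ 2 - ‖c.preVel.1‖ ^ 2| / 2)) =
      collisionSum G ε γ S (fun c => f c.fst *
        (‖c.postVel.1 - c.preVel.1‖ + |‖c.postVel.1‖ ^ 2 - ‖c.preVel.1‖ ^ 2| / 2)) := by
  rw [collisionSum_eq_finset_sum hfin, collisionSum_eq_finset_sum hfin]
  refine Finset.sum_congr rfl fun t _ => ?_
  refine Finset.sum_equiv (Equiv.prodComm (Fin N) (Fin N)) (fun p => ?_) (fun p hp => ?_)
  · rw [Equiv.prodComm_apply, swap_mem_contactPairs_iff hG]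
  · rw [Equiv.prodComm_apply, Prod.fst_swap, Prod.snd_swap]
    simp only [HardSphereCollisionRecord.ofConfig_snd, HardSphereCollisionRecord.ofConfig_fst]
    have hc := (mem_contactPairs.1 hp).2
    have hle : ‖G.sepVec (γ t p.1).1 (γ t p.2).1‖ ≤ ε := le_of_eq (mem_contactSet.1 hc).2
    rw [transferImpulse_swap hG hle]

omit [TopologicalSpace X] in
/-- Regrouping a first-partner-weighted transfer-impulse sum by particles:
`Σ_c f(c.fst) ι(c) = Σ_i f i · A_i` with `A_i = Σ_{c : c.fst = i} ι(c)`. [folklore] -/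
theorem collisionSum_fst_mul_eq_sum_transfer {γ : ℝ → Config N d X} {S : Set ℝ}
    (hfin : (collisionTimes G ε γ ∩ S).Finite) (f : Fin N → ℝ) :
    collisionSum G ε γ S (fun c => f c.fst *
        (‖c.postVel.1 - c.preVel.1‖ + |‖c.postVel.1‖ ^ 2 - ‖c.preVel.1‖ ^ 2| / 2)) =
      ∑ i, f i * collisionSum G ε γ S (fun c => if c.fst = i then
        ‖c.postVel.1 - c.preVel.1‖ + |‖c.postVel.1‖ ^ 2 - ‖c.preVel.1‖ ^ 2| / 2 else 0) := by
  simp only [collisionSum_eq_finset_sum hfin, Finset.mul_sum]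
  rw [Finset.sum_comm]
  refine Finset.sum_congr rfl fun t _ => ?_
  rw [Finset.sum_comm]
  refine Finset.sum_congr rfl fun p _ => ?_
  simp only [HardSphereCollisionRecord.ofConfig_fst, mul_ite, mul_zero]
  rw [Finset.sum_ite_eq Finset.univ p.1]
  simp

/-- **The clamp remainder bound for the transfer impulse, in a general regular geometry** (the proof of
`EntropyClockDock.abs_collisionSum_unclamped_le` with `‖Δv_fst‖` replaced by the transfer impulse). [folklore] -/
theorem abs_collisionSum_unclamped_le_transfer (hG : G.IsHardSphereRegular ε) {γ : ℝ → Config N d X} {S : Set ℝ}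
    (hfin : (collisionTimes G ε γ ∩ S).Finite) {ω : Fin N → ℝ} (hω0 : ∀ i, 0 ≤ ω i) (hω1 : ∀ i, ω i ≤ 1)
    {g : HardSphereCollisionRecord d X N → ℝ} {B : ℝ}
    (hg : ∀ t ∈ collisionTimes G ε γ ∩ S, ∀ p ∈ contactPairs G ε (γ t),
      |g (HardSphereCollisionRecord.ofConfig G ε (γ t) t p.1 p.2)| ≤
        B * (‖(HardSphereCollisionRecord.ofConfig G ε (γ t) t p.1 p.2).postVel.1 -
              (HardSphereCollisionRecord.ofConfig G ε (γ t) t p.1 p.2).preVel.1‖ +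
          |‖(HardSphereCollisionRecord.ofConfig G ε (γ t) t p.1 p.2).postVel.1‖ ^ 2 -
              ‖(HardSphereCollisionRecord.ofConfig G ε (γ t) t p.1 p.2).preVel.1‖ ^ 2| / 2)) :
    |collisionSum G ε γ S (fun c => (1 - ω c.fst * ω c.snd) * g c)| ≤
      2 * B * ∑ i, (1 - ω i) * collisionSum G ε γ S (fun c => if c.fst = i then
        ‖c.postVel.1 - c.preVel.1‖ + |‖c.postVel.1‖ ^ 2 - ‖c.preVel.1‖ ^ 2| / 2 else 0) := by
  -- pointwise: `|(1 - ω_i ω_j) g| ≤ (1 - ω_i) B ι + (1 - ω_j) B ι`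
  have hpt : ∀ t ∈ collisionTimes G ε γ ∩ S, ∀ p ∈ contactPairs G ε (γ t),
      |(1 - ω p.1 * ω p.2) * g (HardSphereCollisionRecord.ofConfig G ε (γ t) t p.1 p.2)| ≤
        (1 - ω p.1) * (B * (‖(HardSphereCollisionRecord.ofConfig G ε (γ t) t p.1 p.2).postVel.1 -
              (HardSphereCollisionRecord.ofConfig G ε (γ t) t p.1 p.2).preVel.1‖ +
            |‖(HardSphereCollisionRecord.ofConfig G ε (γ t) t p.1 p.2).postVel.1‖ ^ 2 -
              ‖(HardSphereCollisionRecord.ofConfig G ε (γ t) t p.1 p.2).preVel.1‖ ^ 2| / 2)) +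
        (1 - ω p.2) * (B * (‖(HardSphereCollisionRecord.ofConfig G ε (γ t) t p.1 p.2).postVel.1 -
              (HardSphereCollisionRecord.ofConfig G ε (γ t) t p.1 p.2).preVel.1‖ +
            |‖(HardSphereCollisionRecord.ofConfig G ε (γ t) t p.1 p.2).postVel.1‖ ^ 2 -
              ‖(HardSphereCollisionRecord.ofConfig G ε (γ t) t p.1 p.2).preVel.1‖ ^ 2| / 2)) := by
    intro t ht p hp
    have h1 : 0 ≤ 1 - ω p.1 * ω p.2 := by nlinarith [hω0 p.1, hω0 p.2, hω1 p.1, hω1 p.2]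
    have h2 : 1 - ω p.1 * ω p.2 ≤ (1 - ω p.1) + (1 - ω p.2) := by nlinarith [hω0 p.1, hω0 p.2, hω1 p.1, hω1 p.2]
    have hB := hg t ht p hp
    have hB0 : 0 ≤ B * (‖(HardSphereCollisionRecord.ofConfig G ε (γ t) t p.1 p.2).postVel.1 -
          (HardSphereCollisionRecord.ofConfig G ε (γ t) t p.1 p.2).preVel.1‖ +
        |‖(HardSphereCollisionRecord.ofConfig G ε (γ t) t p.1 p.2).postVel.1‖ ^ 2 -
          ‖(HardSphereCollisionRecord.ofConfig G ε (γ t) t p.1 p.2).preVel.1‖ ^ 2| / 2) :=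
      (abs_nonneg _).trans hB
    rw [abs_mul, abs_of_nonneg h1, ← add_mul]
    exact mul_le_mul h2 hB (abs_nonneg _) (by linarith [hω1 p.1, hω1 p.2])
  -- sum the pointwise bound
  have hsum : |collisionSum G ε γ S (fun c => (1 - ω c.fst * ω c.snd) * g c)| ≤
      collisionSum G ε γ S (fun c => (1 - ω c.fst) *
          (B * (‖c.postVel.1 - c.preVel.1‖ + |‖c.postVel.1‖ ^ 2 - ‖c.preVel.1‖ ^ 2| / 2))) +
        collisionSum G ε γ S (fun c => (1 - ω c.snd) *
          (B * (‖c.postVel.1 - c.preVel.1‖ + |‖c.postVel.1‖ ^ 2 - ‖c.preVel.1‖ ^ 2| / 2))) := by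
    rw [collisionSum_eq_finset_sum hfin, collisionSum_eq_finset_sum hfin, collisionSum_eq_finset_sum hfin,
      ← Finset.sum_add_distrib]
    refine (Finset.abs_sum_le_sum_abs _ _).trans (Finset.sum_le_sum fun t ht => ?_)
    rw [← Finset.sum_add_distrib]
    refine (Finset.abs_sum_le_sum_abs _ _).trans (Finset.sum_le_sum fun p hp => ?_)
    simp only [HardSphereCollisionRecord.ofConfig_fst, HardSphereCollisionRecord.ofConfig_snd]
    exact hpt t ((Set.Finite.mem_toFinset hfin).1 ht) p hp
  -- the two halves are equal after the swap, and each is `B Σ_i (1 - ω_i) A_i`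
  have hswap : collisionSum G ε γ S (fun c => (1 - ω c.snd) *
        (B * (‖c.postVel.1 - c.preVel.1‖ + |‖c.postVel.1‖ ^ 2 - ‖c.preVel.1‖ ^ 2| / 2))) =
      collisionSum G ε γ S (fun c => (1 - ω c.fst) *
        (B * (‖c.postVel.1 - c.preVel.1‖ + |‖c.postVel.1‖ ^ 2 - ‖c.preVel.1‖ ^ 2| / 2))) := by
    have h := collisionSum_snd_eq_fst_transfer hG hfin (fun i => (1 - ω i) * B)
    simp only [mul_assoc] at h
    exact h
  have hfst : collisionSum G ε γ S (fun c => (1 - ω c.fst) *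
        (B * (‖c.postVel.1 - c.preVel.1‖ + |‖c.postVel.1‖ ^ 2 - ‖c.preVel.1‖ ^ 2| / 2))) =
      B * ∑ i, (1 - ω i) * collisionSum G ε γ S (fun c => if c.fst = i then
        ‖c.postVel.1 - c.preVel.1‖ + |‖c.postVel.1‖ ^ 2 - ‖c.preVel.1‖ ^ 2| / 2 else 0) := by
    have h := collisionSum_fst_mul_eq_sum_transfer hfin (fun i => (1 - ω i) * B)
    simp only [mul_assoc] at h
    rw [h, Finset.mul_sum]
    refine Finset.sum_congr rfl fun i _ => ?_
    ring
  rw [hswap, hfst] at hsum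
  linarith

/-- **STUB S10 `stub_transferClampRemainder`** of line `IdeatorTwoSketch` (crux `ClampedCurrentsDock`, stmt-14680):
the torus instance of `abs_collisionSum_unclamped_le_transfer`. -/
theorem stub_transferClampRemainder : TransferClampRemainder :=
  fun _ε _N _γ _S hG hfin _ω hω0 hω1 _g _B hg => abs_collisionSum_unclamped_le_transfer hG hfin hω0 hω1 hg

end Summit.AtomisticToContinuum.HydrodynamicLimit.Theorems.ClampedCurrentsDockClampRemainder

end
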